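/-
Copyright (c) 2026 the pub-hodgecm-mathlib formalisation cell (harness21).  Prover seat hodgecm-mathlib-A-p19 (g19), topic T5 = P8
«(C♯)hol interior», row «Cc (J-plc)» FILE A (desk F0P2-plan (g8); `F0/P2/T5a-TREE.md` §2b steps (1)+(2)), 2026-08-31.
KERNEL module: THEOREMS ONLY (no definition, no named fact, no `sorry`, no instance, no notation).
-/
import Literature.NumberTheory.Automorphic.Liu2021.ThetaLiftFromLinePureTensor
import Literature.NumberTheory.Automorphic.UnitaryGroupHolCotFormsArchCentre
import Literature.NumberTheory.Automorphic.DiscreteAutomorphicRepNormalFixedVectors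
import Literature.NumberTheory.Automorphic.DiscreteSummandProjection
import HarnessLib

/-!
# Node Cc of the (C♯)hol interior, steps (1)+(2): a HOLOMORPHIC-COTANGENT `P` is fixed by the compact factor `K_c`, so the
# projected theta classes `pr_P [Θ̃_Ψ(f) ∘ ιA]` are INVARIANT under the Weil action of `ιA(K_c) × 1`

Topic `NumberTheory/Automorphic/Liu2021`; namespace `Literature.NumberTheory.Automorphic.Liu2021`.  KERNEL: theorems only.  Cell hodgecm-mathlib
FLOOR 0, programme P2, topic T5 = P8 «(C♯)hol interior» (`F0/P2/T5a-TREE.md` §2b, node Cc = [Liu2021, Lem. D.2 (1)] at the complex places `≠` that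
of `ι`; this file is its steps (1)+(2), the `K_c`-invariance; the junction (J-plc) with the archimedean Weil data and the vacuum computation are
the sequel).

[Liu2021, proof of Prop. 4.13 Case 1, l. 2137–2141]: «`π_{∞i} ≃ ω_{n,0}^{m_i,±,1}` for `i ≥ 2` … By Lemma D.2 …»; at a complex place `w ≠ w(ι)` the group
`U(H)(L⁺_w) ≅ U(3,0)` is compact and an `H¹`-cohomological (cotangent) `P` is TRIVIAL there: the cotangent forms are right-invariant under the
compact factor `K_c = cmCompactFactor L ι H T hT = ∏_{w ≠ w(ι)} U(H)(L⁺_w) × 1_f` (★ `mem_holCotForms_iff`), `K_c` is normal (★ `normal_cmCompactFactor`),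
and an irreducible `P` with ONE non-zero `K_c`-fixed vector is `K_c`-fixed vector by vector (★ `DiscreteAutomorphicRep.rightRegular_eq_self_of_form`).
Consequently the projected theta classes, which satisfy `R(k) [Θ̃_Ψ(f) ∘ ιA] = [Θ̃_{ω(ιA k, 1)Ψ}(f) ∘ ιA]` (★ `rightRegular_toLp_lineThetaLift`) and
`pr_P ∘ R(k) = R(k) ∘ pr_P` (★ `starProjection_rightRegular`), are invariant: `pr_P [Θ̃_{ω(ιA k,1)Ψ}(f) ∘ ιA] = pr_P [Θ̃_Ψ(f) ∘ ιA]` for `k ∈ K_c` —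
the theta functional `Ψ ↦ pr_P [Θ̃_Ψ(f) ∘ ιA]` factors through the co-invariants of `ω|_{ιA(K_c) × 1}`; at a definite place this is the input
«a `U(V_w)`-invariant functional is non-zero» of the vacuum dichotomy ([KonnoKonno2007, Lem. 5.2]; [KashiwaraVergne1978]).

* `rightRegular_eq_self_of_mem_cmCompactFactor` — `R(k) v = v` for `k ∈ K_c`, `v ∈ P`, once `P` contains a non-zero holomorphic-cotangent
  coordinate class (the `IsHolCotangentAt` datum made explicit as in ★ `MeetsThetaLiftFromLine.exists_chi_starProjection_ne_zero_of_holCotForm`);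
* `rightRegular_starProjection_of_mem_cmCompactFactor` — `R(k) (pr_P x) = pr_P x` for every `x ∈ L²([U(H)])`, `k ∈ K_c`;
* **`starProjection_toLp_lineThetaLift_pairRep_of_mem_cmCompactFactor`** — `pr_P [Θ̃_{ω(ιA k, 1)Ψ}(f) ∘ ιA] = pr_P [Θ̃_Ψ(f) ∘ ιA]` (`k ∈ K_c`,
  any Schwartz–Bruhat `Ψ`, any weight `f`);
* `starProjection_toLp_lineThetaLift_pairRep_sub_of_mem_cmCompactFactor` — the same as «`pr_P` kills `[Θ̃_{ω(ιA k,1)Ψ − Ψ}(f) ∘ ιA]`».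

HONEST SCOPE.  Nothing of [Liu2021] is asserted; nothing archimedean is computed here (no `m_w`, no vacuum): this is the representation-theoretic
half of Cc; the sequel needs the junction (J-plc) of ★ `pairRep … (chiSplittingLine …)` at `archSingle w u` with an `IsArchWeilDatum` at `w`.  HC_CM is
proved only modulo the printed citations until rung 0 closes; this file books nothing and discharges nothing booked.

## References
* [Liu2021] Y. Liu, Camb. J. Math. 9 (2021) = arXiv:2102.11518, proof of Prop. 4.13 Case 1 (l. 2137–2141, p. 48); App. D Lem. D.2 (1) (l. 5283).
* [BorelJacquet1979] A. Borel, H. Jacquet, PSPM 33.1 (1979), §4.1 (`G(𝔸) = G_∞ × G(𝔸_f)`), §4.6 (`π ≅ ⊗_v π_v`; `π_v` trivial where `π` has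
  `G_v`-fixed vectors).
* [DeitmarEchterhoff2014] A. Deitmar, S. Echterhoff, *Principles of Harmonic Analysis*, 2nd ed., Thm. 7.3.2.
* [KonnoKonno2007] T. Konno, K. Konno, Kyushu J. Math. 61 (2007), Lem. 5.2, Thm. 5.4.  [KashiwaraVergne1978] Invent. Math. 44 (1978), (5.1)–(5.5).
-/

set_option autoImplicit false

noncomputable section

open NumberField MeasureTheory IsDedekindDomain
open scoped Matrix ComplexOrder ENNReal

namespace Literature.NumberTheory.Automorphic.Liu2021

open _root_.MeasureTheory
open Literature.NumberTheory.Automorphic Literature.NumberTheory.Automorphic.UnitaryGroup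
open Literature.NumberTheory.Automorphic.UnitaryGroup.CotangentForms
open Literature.NumberTheory.Automorphic.IdeleClassGroup
open Literature.NumberTheory.Automorphic.Liu2021.Def411WeilCarriers
open Literature.NumberTheory.Automorphic.Liu2021.Def411WeilCarriersDoubling
open Literature.NumberTheory.GelbartRogawski1991 Literature.NumberTheory.GelbartRogawski1991.UnitaryDualPair
open Literature.NumberTheory.Weil1964
open Literature.RepresentationTheory.Liu2021

/-! ## §1 A holomorphic-cotangent `P` is fixed by the compact factor `K_c` -/

section Fixed

variable (L : Type) [Field L] [NumberField L] [IsCMField L] (ι : L →+* ℂ) (H : Matrix (Fin 3) (Fin 3) L) (T : GL (Fin 3) ℂ)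
  (hT : (T : Matrix (Fin 3) (Fin 3) ℂ)ᴴ * H.map ι * (T : Matrix (Fin 3) (Fin 3) ℂ) = Literature.Geometry.ComplexHyperbolic.BallModel.J)
  {μA : Measure (adelicGroupData (↥(maximalRealSubfield L)) L (IsCMField.complexConj L) 3 H).automorphicQuotient}
  [(adelicGroupData (↥(maximalRealSubfield L)) L (IsCMField.complexConj L) 3 H).IsAutomorphicMeasure μA]
  (P : DiscreteAutomorphicRep (adelicGroupData (↥(maximalRealSubfield L)) L (IsCMField.complexConj L) 3 H) μA)
  {Φh : (adelicGroupData (↥(maximalRealSubfield L)) L (IsCMField.complexConj L) 3 H).Adelic → (Fin 2 → ℂ)}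
  (hΦh : Φh ∈ holCotForms (↥(maximalRealSubfield L)) L (IsCMField.complexConj L) 3 H (cmArchSection L ι H T hT)
    (cmCompactFactor L ι H T hT))
  {j : Fin 2} (hj : MemLp (toQuotFun (adelicGroupData (↥(maximalRealSubfield L)) L (IsCMField.complexConj L) 3 H) fun x => Φh x j) 2 μA)
  (hjmem : hj.toLp _ ∈ P.space.toSubmodule) (hjne : hj.toLp _ ≠ 0)

include hΦh hjmem hjne in
/-- **A holomorphic-cotangent `P` is `K_c`-FIXED vector by vector**: if the discrete `P` of `U(H)` contains a non-zero coordinate class of a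
holomorphic cotangent form (right-`K_c`-invariant by ★ `mem_holCotForms_iff`, left-invariant under the rational points by ★
`left_inv_of_mem_holCotForms`), then `R(k) v = v` for every `k ∈ K_c = cmCompactFactor …` and every `v ∈ P` (★
`DiscreteAutomorphicRep.rightRegular_eq_self_of_form` with ★ `normal_cmCompactFactor`). [cite: BorelJacquet1979, §4.6]
[cite: DeitmarEchterhoff2014, Thm. 7.3.2] -/
theorem rightRegular_eq_self_of_mem_cmCompactFactor
    {k : (adelicGroupData (↥(maximalRealSubfield L)) L (IsCMField.complexConj L) 3 H).Adelic} (hk : k ∈ cmCompactFactor L ι H T hT)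
    {v : (adelicGroupData (↥(maximalRealSubfield L)) L (IsCMField.complexConj L) 3 H).L2 μA} (hv : v ∈ P.space) :
    (adelicGroupData (↥(maximalRealSubfield L)) L (IsCMField.complexConj L) 3 H).rightRegular μA k v = v :=
  P.rightRegular_eq_self_of_form (normal_cmCompactFactor L ι H T hT) (left_inv_of_mem_holCotForms L ι H T hT hΦh j)
    (fun k hk x => by
      show Φh (x * k) j = Φh x j
      rw [(mem_holCotForms_iff.mp hΦh).2.1 k hk x]) hj hjmem hjne k hk v hv

include hΦh hjmem hjne in
/-- `R(k) (pr_P x) = pr_P x` for `k ∈ K_c` and every `x ∈ L²([U(H)])` (the projection lands in `P`, ★ `Submodule.starProjection_apply_mem`).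
[cite: BorelJacquet1979, §4.6] -/
theorem rightRegular_starProjection_of_mem_cmCompactFactor
    {k : (adelicGroupData (↥(maximalRealSubfield L)) L (IsCMField.complexConj L) 3 H).Adelic} (hk : k ∈ cmCompactFactor L ι H T hT)
    (x : (adelicGroupData (↥(maximalRealSubfield L)) L (IsCMField.complexConj L) 3 H).L2 μA) :
    (adelicGroupData (↥(maximalRealSubfield L)) L (IsCMField.complexConj L) 3 H).rightRegular μA k (P.space.toSubmodule.starProjection x) =
      P.space.toSubmodule.starProjection x :=
  rightRegular_eq_self_of_mem_cmCompactFactor L ι H T hT P hΦh hj hjmem hjne hk (P.space.toSubmodule.starProjection_apply_mem x)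

end Fixed

/-! ## §2 The projected theta classes are invariant under `ιA(K_c) × 1` -/

section Theta

variable (L : Type) [Field L] [NumberField L] [IsCMField L] (ι : L →+* ℂ) (H : Matrix (Fin 3) (Fin 3) L) (T : GL (Fin 3) ℂ)
  (hT : (T : Matrix (Fin 3) (Fin 3) ℂ)ᴴ * H.map ι * (T : Matrix (Fin 3) (Fin 3) ℂ) = Literature.Geometry.ComplexHyperbolic.BallModel.J)
  {n' : ℕ} (e₁ : Fin 3 × Fin 1 ≃ Fin n') (dV : Fin 3 → L) (hdV : ∀ i, IsCMField.complexConj L (dV i) = dV i)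
  (hdV0 : ∀ i, dV i ≠ 0) (g : GL (Fin 3) L)
  (hg : ((g : Matrix (Fin 3) (Fin 3) L).map (cmConjRingHom L))ᵀ * H * (g : Matrix (Fin 3) (Fin 3) L) = Matrix.diagonal dV)
  (μ : Literature.NumberTheory.Automorphic.IdeleClassGroup L →ₜ* Circle) (hμ : IsConjugateSymplectic L μ) (a : (↥(maximalRealSubfield L))ˣ)
  (hρ : HasThetaMajorants fun
      (p : ↥(UnitaryGroup.adelic (↥(maximalRealSubfield L)) L (IsCMField.complexConj L) 3 (Matrix.diagonal dV)) × ↥(UnitaryGroup.adelic (↥(maximalRealSubfield L)) L (IsCMField.complexConj L) 1 (JW (↥(maximalRealSubfield L)) L a))) (Φ : piSchwartzBruhat (↥(maximalRealSubfield L)) (Fin n')) =>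
        pairRep (↥(maximalRealSubfield L)) L (IsCMField.complexConj L) 3 1 e₁ (Matrix.diagonal dV) (JW (↥(maximalRealSubfield L)) L a)
          (chiSplittingLine L e₁ dV hdV hdV0 (toHeckeCharacter L μ) (isUnitary_toHeckeCharacter L μ)
            ((isOscillatorChar_toHeckeCharacter_iff μ).mpr hμ) (TW (↥(maximalRealSubfield L)) a)
            (isUnit_det_TW (↥(maximalRealSubfield L)) a) (JW (↥(maximalRealSubfield L)) L a) (JW_eq (↥(maximalRealSubfield L)) L a))
          p Φ)
  [CompactSpace (↥(UnitaryGroup.adelic (↥(maximalRealSubfield L)) L (IsCMField.complexConj L) 3 (Matrix.diagonal dV)) ⧸ (UnitaryGroup.toAdelic (↥(maximalRealSubfield L)) L (IsCMField.complexConj L) 3 (Matrix.diagonal dV)).range)] [MeasurableSpace (↥(UnitaryGroup.adelic (↥(maximalRealSubfield L)) L (IsCMField.complexConj L) 1 (JW (↥(maximalRealSubfield L)) L a)) ⧸ (UnitaryGroup.toAdelic (↥(maximalRealSubfield L)) L (IsCMField.complexConj L) 1 (JW (↥(maximalRealSubfield L)) L a)).range)] [BorelSpace (↥(UnitaryGroup.adelic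 (↥(maximalRealSubfield L)) L (IsCMField.complexConj L) 1 (JW (↥(maximalRealSubfield L)) L a)) ⧸ (UnitaryGroup.toAdelic (↥(maximalRealSubfield L)) L (IsCMField.complexConj L) 1 (JW (↥(maximalRealSubfield L)) L a)).range)] (μW : Measure (↥(UnitaryGroup.adelic (↥(maximalRealSubfield L)) L (IsCMField.complexConj L) 1 (JW (↥(maximalRealSubfield L)) L a)) ⧸ (UnitaryGroup.toAdelic (↥(maximalRealSubfield L)) L (IsCMField.complexConj L) 1 (JW (↥(maximalRealSubfield L)) L a)).range)) [IsFiniteMeasure μW]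
  (Ψ : piSchwartzBruhat (↥(maximalRealSubfield L)) (Fin n'))
  (f : C((↥(UnitaryGroup.adelic (↥(maximalRealSubfield L)) L (IsCMField.complexConj L) 1 (JW (↥(maximalRealSubfield L)) L a)) ⧸ (UnitaryGroup.toAdelic (↥(maximalRealSubfield L)) L (IsCMField.complexConj L) 1 (JW (↥(maximalRealSubfield L)) L a)).range), ℂ))
  {μA : Measure (adelicGroupData (↥(maximalRealSubfield L)) L (IsCMField.complexConj L) 3 H).automorphicQuotient}
  [(adelicGroupData (↥(maximalRealSubfield L)) L (IsCMField.complexConj L) 3 H).IsAutomorphicMeasure μA]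
  [CompactSpace (adelicGroupData (↥(maximalRealSubfield L)) L (IsCMField.complexConj L) 3 H).automorphicQuotient]
  (P : DiscreteAutomorphicRep (adelicGroupData (↥(maximalRealSubfield L)) L (IsCMField.complexConj L) 3 H) μA)
  {Φh : (adelicGroupData (↥(maximalRealSubfield L)) L (IsCMField.complexConj L) 3 H).Adelic → (Fin 2 → ℂ)}
  (hΦh : Φh ∈ holCotForms (↥(maximalRealSubfield L)) L (IsCMField.complexConj L) 3 H (cmArchSection L ι H T hT)
    (cmCompactFactor L ι H T hT))
  {j : Fin 2} (hj : MemLp (toQuotFun (adelicGroupData (↥(maximalRealSubfield L)) L (IsCMField.complexConj L) 3 H) fun x => Φh x j) 2 μA)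
  (hjmem : hj.toLp _ ∈ P.space.toSubmodule) (hjne : hj.toLp _ ≠ 0)

include hΦh hjmem hjne in
/-- **THE PROJECTED THETA CLASSES ARE `ιA(K_c) × 1`-INVARIANT**: for a holomorphic-cotangent `P` (one non-zero coordinate class in `P`),
every `k ∈ K_c = cmCompactFactor …`, every Schwartz–Bruhat `Ψ` and every weight `f`:
`pr_P [Θ̃_{ω(ιA k, 1)Ψ}(f) ∘ ιA] = pr_P [Θ̃_Ψ(f) ∘ ιA]` (★ `rightRegular_toLp_lineThetaLift`: the left side is `pr_P (R(k) [Θ̃_Ψ(f) ∘ ιA])`;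
★ `starProjection_rightRegular`; §1).  At a definite place `w` (`U(H)(L⁺_w) ≤ K_c`) this is Liu's «`π_{∞,w}` is the trivial character» read on the
theta lift: the theta functional is `U(V_w)`-invariant. [cite: Liu2021, proof of Prop. 4.13 Case 1 (l. 2137–2141, p. 48); App. D Lem. D.2 (1) (l. 5283)]
[cite: BorelJacquet1979, §4.6] -/
theorem starProjection_toLp_lineThetaLift_pairRep_of_mem_cmCompactFactor
    {k : (adelicGroupData (↥(maximalRealSubfield L)) L (IsCMField.complexConj L) 3 H).Adelic} (hk : k ∈ cmCompactFactor L ι H T hT) :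
    P.space.toSubmodule.starProjection
        (MemLp.toLp _ (memLp_toQuotFun_lineThetaLift L 3 H e₁ dV hdV hdV0 g hg μ hμ a hρ μW
          ((pairRep (↥(maximalRealSubfield L)) L (IsCMField.complexConj L) 3 1 e₁ (Matrix.diagonal dV) (JW (↥(maximalRealSubfield L)) L a)
            (chiSplittingLine L e₁ dV hdV hdV0 (toHeckeCharacter L μ) (isUnitary_toHeckeCharacter L μ)
              ((isOscillatorChar_toHeckeCharacter_iff μ).mpr hμ) (TW (↥(maximalRealSubfield L)) a)
              (isUnit_det_TW (↥(maximalRealSubfield L)) a) (JW (↥(maximalRealSubfield L)) L a) (JW_eq (↥(maximalRealSubfield L)) L a)))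
            ((cmAdelicFrameTransport L 3 H dV g hg) k, 1) Ψ) f μA 2)) =
      P.space.toSubmodule.starProjection
        (MemLp.toLp _ (memLp_toQuotFun_lineThetaLift L 3 H e₁ dV hdV hdV0 g hg μ hμ a hρ μW Ψ f μA 2)) := by
  rw [← rightRegular_toLp_lineThetaLift L 3 H e₁ dV hdV hdV0 g hg μ hμ a hρ μW Ψ f μA k,
    DiscreteAutomorphicRep.starProjection_rightRegular]
  exact rightRegular_starProjection_of_mem_cmCompactFactor L ι H T hT P hΦh hj hjmem hjne hk _

include hΦh hjmem hjne in
/-- **Coinvariant form**: `pr_P` kills the class of `ω(ιA k, 1)Ψ − Ψ` for `k ∈ K_c` — the theta functional `Ψ ↦ pr_P [Θ̃_Ψ(f) ∘ ιA]`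
factors through the co-invariants of the Weil representation restricted to `ιA(K_c) × 1`. [cite: Liu2021, App. D Lem. D.2 (1) (l. 5283)]
[cite: BorelJacquet1979, §4.6] -/
theorem starProjection_toLp_lineThetaLift_pairRep_sub_of_mem_cmCompactFactor
    {k : (adelicGroupData (↥(maximalRealSubfield L)) L (IsCMField.complexConj L) 3 H).Adelic} (hk : k ∈ cmCompactFactor L ι H T hT) :
    P.space.toSubmodule.starProjection
        (MemLp.toLp _ (memLp_toQuotFun_lineThetaLift L 3 H e₁ dV hdV hdV0 g hg μ hμ a hρ μW
          ((pairRep (↥(maximalRealSubfield L)) L (IsCMField.complexConj L) 3 1 e₁ (Matrix.diagonal dV) (JW (↥(maximalRealSubfield L)) L a)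
            (chiSplittingLine L e₁ dV hdV hdV0 (toHeckeCharacter L μ) (isUnitary_toHeckeCharacter L μ)
              ((isOscillatorChar_toHeckeCharacter_iff μ).mpr hμ) (TW (↥(maximalRealSubfield L)) a)
              (isUnit_det_TW (↥(maximalRealSubfield L)) a) (JW (↥(maximalRealSubfield L)) L a) (JW_eq (↥(maximalRealSubfield L)) L a)))
            ((cmAdelicFrameTransport L 3 H dV g hg) k, 1) Ψ - Ψ) f μA 2)) = 0 := by
  rw [sub_eq_add_neg, toLp_lineThetaLift_add_left L 3 H e₁ dV hdV hdV0 g hg μ hμ a hρ μW f μA, map_add,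
    starProjection_toLp_lineThetaLift_pairRep_of_mem_cmCompactFactor L ι H T hT e₁ dV hdV hdV0 g hg μ hμ a hρ μW Ψ f P hΦh hj hjmem hjne hk,
    ← neg_one_smul ℂ Ψ, toLp_lineThetaLift_smul_left L 3 H e₁ dV hdV hdV0 g hg μ hμ a hρ μW f μA, map_smul, neg_one_smul,
    add_neg_cancel]

end Theta

end Literature.NumberTheory.Automorphic.Liu2021

end
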